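import Summits.MatrixMultiplication.OmegaCensus.STPP211Z2pow6NFMapsD
import Summits.MatrixMultiplication.OmegaCensus.STPP211CosetLaw
import Literature.Computability.AlgebraicComplexity.STPPTranslation
import Literature.Computability.AlgebraicComplexity.STPPGlobalShift
import Literature.Computability.AlgebraicComplexity.STPPMapHom

/-!
# (2,1,1)¹⁰ ⊄ (ℤ/2)⁶ — part H2: every family has a FRAME NORMAL FORM (GL descent)

Cell `pub-omega` (unit `pub-omega-stpp-1-g36`), topic `Summits/MatrixMultiplication/OmegaCensus`.
HONEST FRAMING (verbatim): lottery ticket; floor = certified bounds/negative ranges. Census STRUCTURE bookkeeping (B5, `T1((ℤ/2)⁶)`, Pb237);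
nothing here is a bound on `ω`.

**`exists_frameNF`: every STPP family of size pattern `(2,1,1)¹⁰` in `G6 = (ℤ/2)⁶` yields a TRANSLATION NORMAL FORM family
`(A'ᵢ, {0}, {c'ᵢ})` (all `#A'ᵢ = 2`) whose `c`-set is a FRAME NORMAL FORM `base d ∪ R` — `base d = {0, u 0, …, u (d−1)}`, `R ⊆ free d =
span d ∖ base d`, `#R = 9 − d`, `d ∈ {4, 5, 6}`.** Port of `STPP211Z2pow5NormalForm` (seat g35) one dimension up and four blocks more:
per-member translation (`Bᵢ ↦ {0}`), the global `C`-shift (`c₀ ↦ 0`), and the GL descent by the maps `phi j v` of `STPP211Z2pow6NFMapsD`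
(`j = 0 … 5`: while some `cᵢ` has code `≥ 2ʲ`, send it to `u j` fixing the lower span); `d ≤ 3` is excluded by counting (`#span d ≤ 8 < 10`).
The second stage (coordinate-permutation canonical forms of the 44 672 frame normal forms → 456 classes → the 29 `AGL(6,2)` representatives
by 456 kernel-checked certificates; offline table HOME `pub-omega-stpp-1-g36/code/s3/nf_certs.json`) is the successor's part H3.

References: H. Cohn, R. Kleinberg, B. Szegedy, C. Umans, FOCS 2005 (arXiv:math/0511460), Def. 5.1.
-/

namespace Summit.MatrixMultiplication.OmegaCensus

namespace T1Z2p6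

open Finset Literature.Computability.AlgebraicComplexity

/-! ## Normal-form states and the moves -/

/-- In `𝔽₂⁶` every element is its own inverse (additive form). -/
theorem add_self6 : ∀ x : G6, x + x = 0 := by decide

/-- A family in translation normal form: `Bᵢ = {0}`, `Cᵢ = {cᵢ}`, `#Aᵢ = 2`, STPP. -/
structure NFState (A : Fin 10 → Finset G6) (c : Fin 10 → G6) : Prop where
  /-- the STPP -/
  stpp : IsSTPP A (fun _ => ({0} : Finset G6)) (fun i => {c i})
  /-- the cards -/
  card_two : ∀ i, (A i).card = 2

namespace NFState

variable {A : Fin 10 → Finset G6} {c : Fin 10 → G6}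

/-- The `c`'s of a normal-form state are distinct. -/
theorem c_injective (h : NFState A c) : Function.Injective c :=
  T1Coset.c_injective h.stpp fun i => card_pos.1 (by rw [h.card_two i]; norm_num)

/-- MOVE 1: the global `C`-shift. -/
theorem shiftC (h : NFState A c) (γ : G6) : NFState A (fun i => c i + γ) := by
  have hst := h.stpp.shiftBC 0 γ
  simp only [image_singleton, add_zero] at hst
  exact ⟨hst, h.card_two⟩

/-- MOVE 2: an injective homomorphism. -/
theorem map (h : NFState A c) (φ : G6 →+ G6) (hφ : Function.Injective φ) :
    NFState (fun i => (A i).image φ) (fun i => φ (c i)) := by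
  have hst := h.stpp.map_of_injective φ hφ
  simp only [image_singleton, map_zero] at hst
  exact ⟨hst, fun i => by rw [card_image_of_injective _ hφ]; exact h.card_two i⟩

/-- MOVE 3: re-indexing by a bijection. -/
theorem reindex (h : NFState A c) (σ : Fin 10 ≃ Fin 10) : NFState (fun i => A (σ i)) (fun i => c (σ i)) :=
  ⟨h.stpp.comp_of_injective σ σ.injective, fun i => h.card_two (σ i)⟩

end NFState

/-! ## From a family to a normal-form state -/

/-- STAGE 0: translate every member so that `Bᵢ = {0}`. [cite: CohnKleinbergSzegedyUmans2005, Def. 5.1] -/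
theorem nf_stage0 {A B C : Fin 10 → Finset G6} (hS : IsSTPP A B C) (hc : ∀ i, (A i).card = 2 ∧ (B i).card = 1 ∧ (C i).card = 1) :
    ∃ A' c', NFState A' c' := by
  have hb : ∀ i, ∃ b, B i = {b} := fun i => card_eq_one.1 (hc i).2.1
  have hc' : ∀ i, ∃ x, C i = {x} := fun i => card_eq_one.1 (hc i).2.2
  choose b hb using hb
  choose c₀ hc₀ using hc'
  have hst := hS.translate fun i => -b i
  have hB : (fun i => (B i).image (· + -b i)) = fun _ => ({0} : Finset G6) := by
    funext i; rw [hb i, image_singleton, add_neg_cancel]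
  have hC : (fun i => (C i).image (· + -b i)) = fun i => ({c₀ i + -b i} : Finset G6) := by
    funext i; rw [hc₀ i, image_singleton]
  rw [hB, hC] at hst
  exact ⟨_, _, hst, fun i => by rw [card_image_of_injective _ (add_left_injective _)]; exact (hc i).1⟩

/-! ## The GL descent of the `c`-codes -/

/-- The invariant after `j` successful steps: normal form, `u 0 … u (j−1)` and `0` among the `c`'s. -/
def Inv (j : ℕ) (A : Fin 10 → Finset G6) (c : Fin 10 → G6) : Prop :=
  NFState A c ∧ (∀ l < j, ∃ i, c i = u l) ∧ ∃ i, c i = 0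

/-- ONE STEP: either every `cᵢ` already has code `< 2ʲ`, or a normal-form map produces the invariant for `j + 1`. -/
theorem inv_step {j : ℕ} (hj : j < 6) {A : Fin 10 → Finset G6} {c : Fin 10 → G6} (h : Inv j A c) :
    (∀ i, enc (c i) < 2 ^ j) ∨ ∃ A' c', Inv (j + 1) A' c' := by
  by_cases hex : ∃ i, 2 ^ j ≤ enc (c i)
  · right
    obtain ⟨i, hi⟩ := hex
    obtain ⟨hN, hu, i₀, hi₀⟩ := h
    refine ⟨_, _, hN.map (phi ⟨j, hj⟩ (c i)) (phi_injective _ _), fun l hl => ?_, i₀, by simp [hi₀]⟩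
    rcases Nat.lt_succ_iff_lt_or_eq.1 hl with hl | rfl
    · obtain ⟨i', hi'⟩ := hu l hl
      refine ⟨i', ?_⟩
      simp only [hi']
      exact phi_fix ⟨j, hj⟩ hi (by rw [enc_u l (by omega)]; exact Nat.pow_lt_pow_right (by norm_num) hl)
    · exact ⟨i, phi_self ⟨l, hj⟩ hi⟩
  · left
    intro i
    exact Nat.lt_of_not_le fun hle => hex ⟨i, hle⟩

/-- DESCENT: from the invariant at `j` reach some `d ≤ 6` with the invariant and all codes `< 2ᵈ`. -/
theorem inv_descend : ∀ (k j : ℕ), j + k = 6 → ∀ {A : Fin 10 → Finset G6} {c : Fin 10 → G6}, Inv j A c →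
    ∃ d, d ≤ 6 ∧ ∃ A' c', Inv d A' c' ∧ ∀ i, enc (c' i) < 2 ^ d
  | 0, j, hjk, A, c, h => ⟨6, le_rfl, A, c, by rw [show j = 6 by omega] at h; exact h, fun i => by
      have := enc_lt (c i); norm_num; exact this⟩
  | k + 1, j, hjk, A, c, h => by
      rcases inv_step (by omega) h with hall | ⟨A', c', h'⟩
      · exact ⟨j, by omega, A, c, h, hall⟩
      · exact inv_descend k (j + 1) (by omega) h'

/-! ## The frame normal form -/

/-- The span of `u 0 … u (d−1)`: elements with code `< 2ᵈ`. -/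
def span (d : ℕ) : Finset G6 := univ.filter fun x => enc x < 2 ^ d

/-- The basic elements `{0} ∪ {u l : l < d}` of a frame normal form. -/
def base (d : ℕ) : Finset G6 := insert 0 ((range d).image u)

/-- The free part of `span d`. -/
def free (d : ℕ) : Finset G6 := span d \ base d

/-- `#(base d) = d + 1` for `d ≤ 6` (kernel check). -/
theorem card_base : ∀ d ∈ range 7, (base d).card = d + 1 := by decide +kernel

/-- `base d ⊆ span d` (kernel check). -/
theorem base_subset_span : ∀ d ∈ range 7, base d ⊆ span d := by decide +kernel

/-- For `d ≤ 3` the span is too small to hold ten points (kernel check). -/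
theorem card_span_le : ∀ d ∈ range 4, (span d).card ≤ 8 := by decide +kernel

/-- The `c`-set of a state satisfying the invariant with all codes `< 2ᵈ` is `base d ∪ R` with `R ∈ (free d).powersetCard (9 − d)` and
`d ∈ {4, 5, 6}`. -/
theorem cset_shape {d : ℕ} (hd : d ≤ 6) {A : Fin 10 → Finset G6} {c : Fin 10 → G6} (h : Inv d A c) (hlt : ∀ i, enc (c i) < 2 ^ d) :
    d ∈ ({4, 5, 6} : Finset ℕ) ∧ ∃ R ∈ (free d).powersetCard (9 - d), univ.image c = base d ∪ R := by
  obtain ⟨hN, hu, i₀, hi₀⟩ := h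
  set T := univ.image c with hT
  have hTcard : T.card = 10 := by rw [hT, card_image_of_injective _ hN.c_injective, card_univ, Fintype.card_fin]
  have hTspan : T ⊆ span d := by
    intro x hx
    obtain ⟨i, _, rfl⟩ := mem_image.1 hx
    exact mem_filter.2 ⟨mem_univ _, hlt i⟩
  have hbase : base d ⊆ T := by
    intro x hx
    rw [base, mem_insert, mem_image] at hx
    rcases hx with rfl | ⟨l, hl, rfl⟩
    · exact mem_image.2 ⟨i₀, mem_univ _, hi₀⟩
    · obtain ⟨i, hi⟩ := hu l (mem_range.1 hl)
      exact mem_image.2 ⟨i, mem_univ _, hi⟩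
  have hd4 : 4 ≤ d := by
    by_contra hlt4
    have := (card_le_card hTspan).trans (card_span_le d (mem_range.2 (by omega)))
    omega
  have hdmem : d ∈ ({4, 5, 6} : Finset ℕ) := by
    simp only [mem_insert, mem_singleton]; omega
  refine ⟨hdmem, T \ base d, ?_, (union_sdiff_of_subset hbase).symm⟩
  rw [mem_powersetCard]
  refine ⟨sdiff_subset_sdiff hTspan le_rfl, ?_⟩
  rw [card_sdiff_of_subset hbase, hTcard, card_base d (mem_range.2 (by omega))]
  omega

/-- **EVERY `(2,1,1)¹⁰` FAMILY OF `(ℤ/2)⁶` HAS A FRAME NORMAL FORM**: a translation-normal-form family `(A'ᵢ, {0}, {c'ᵢ})` (all `#A'ᵢ = 2`)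
whose `c`-set is `base d ∪ R` with `d ∈ {4, 5, 6}`, `R ⊆ free d`, `#R = 9 − d`. [cite: CohnKleinbergSzegedyUmans2005, Def. 5.1] -/
theorem exists_frameNF {A B C : Fin 10 → Finset G6} (hS : IsSTPP A B C)
    (hc : ∀ i, (A i).card = 2 ∧ (B i).card = 1 ∧ (C i).card = 1) :
    ∃ d ∈ ({4, 5, 6} : Finset ℕ), ∃ R ∈ (free d).powersetCard (9 - d), ∃ (A' : Fin 10 → Finset G6) (c' : Fin 10 → G6),
      IsSTPP A' (fun _ => ({0} : Finset G6)) (fun i => {c' i}) ∧ (∀ i, (A' i).card = 2) ∧ univ.image c' = base d ∪ R := by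
  -- stage 0 and the shift `c₀ ↦ 0`
  obtain ⟨A₀, c₀, h₀⟩ := nf_stage0 hS hc
  have h₁ := h₀.shiftC (c₀ 0)
  have hinv : Inv 0 A₀ (fun i => c₀ i + c₀ 0) := ⟨h₁, fun l hl => absurd hl (Nat.not_lt_zero _), 0, add_self6 _⟩
  -- the GL descent
  obtain ⟨d, hd, A₂, c₂, hinv₂, hlt⟩ := inv_descend 6 0 rfl hinv
  obtain ⟨hdmem, R, hR, hset⟩ := cset_shape hd hinv₂ hlt
  exact ⟨d, hdmem, R, hR, A₂, c₂, hinv₂.1.stpp, hinv₂.1.card_two, hset⟩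

end T1Z2p6

end Summit.MatrixMultiplication.OmegaCensus
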